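import Literature.MathematicalPhysics.QuantumFieldTheory.Balaban1983to89.Beta.OneStepResolventKernel

/-!
# `BalabanUV.Beta.GAN24.TaylorTrilinearLattice` — binder row G-an2-4 ∕ (CONV-C), S-slot, road «S3-Taylor», generic leaf
# W3 (`SKELETON-S3.md` v1.0 §12.7 ∕ §14.2; register engine «TAYLOR-W3*»; owner RULINGS-5 «want W3; file as
# `GAN24/TaylorTrilinear`»), PART 1 of 2: LATTICE-PATH TELESCOPING in the block-label `ℓ¹` currency, THREE-CENTRE BLOCK
# SUMS, and THE REORDERING of the Wilson-channel unit sandwich of `E3UnitSplit.e3W_unit_split`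

G-an2-4 formalisation swarm, leaf prover 19 (unit `b2b-balaban-gan24-formalise-leaf-19`, gen 13).  HONEST FRAMING (cell
rule, verbatim): «discharging `BetaPertH` makes Bałaban's UV stability UNCONDITIONAL — a real constructive-QFT result; it
is NOT the continuum limit and NOT the Clay problem.»  HONEST DEPENDENCY (verbatim): «continuum YM on T⁴ ⇐ BetaPertH ∧
nine spine estimates (0/9 proved); BetaPertH ⇐ (D1) ∧ (D4) ∧ CAP+tail; G-an2-4 gates asym, D1 and NE2/3/4.»  NOT IN
PRINT; OUR BOOKKEEPING ([folklore]): elementary real analysis on `ℤ^{d+1}`, GENERIC `d`, GENERIC blocking `N ≥ 1`,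
ABSTRACT legs `G H K` and table `T`; NO object of an2's typed `U = 1` system occurs, nothing is cited, no `def … : Prop`,
NOTHING asserted or discharged of «E3Shape»∕«E3SupRate» (OPEN, not in print), of (hS, hSall), of the K-slot, of
`BetaPertH`.  NOT BetaPertH, NOT continuum, NOT Clay.

CONTEXT (asserted nowhere below).  Road «S3-Taylor» (`HOME/b2b-balaban-gan24-p1/SKELETON-S3.md` v1.0 §12.6–§12.7)
proves row W of the kernel END `StencilSlotE3OfPieces.e3Shape_of_pieces` from the (PC-1) unit split
`E3UnitSplit.e3W_unit_split` (tree), W1 (vanishing row sums of the Wilson table, leaf-15 `GAN24/WilsonVertexSumZero`),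
(N1)∕(N1′) (block-label decay and UNIT GRADIENTS of the normalised minimiser legs, leaf-16 `GAN24/FineReadout*`), W4
(block sums, leaf-04 `GAN24/TaylorBlockSum`) and W3 = part 2 `GAN24/TaylorTrilinear.trilinear_taylor_bound`: «the ONE
explicit `N` on the table is cashed against ONE unit gradient after subtracting `G l u · K l′ u` inside the zero row sum».

## What is proved ([folklore], `0 sorry`; `quo N` = `LatticeForm.quo` the block label, `l1` = `B12Sec2to5.l1`)
* §0 BLOCK LABELS ARE 1-LIPSCHITZ: `abs_ediv_sub_ediv_le` (`|b/N − a/N| ≤ |b − a|`), `l1_quo_sub_quo_le`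
  (`|quo N z − quo N u|₁ ≤ |z − u|₁`), `exp_quo_weight_le` (`e^{−δ|quo N b − p|₁} ≤ e^{δ|b − u|₁}·e^{−δ|quo N u − p|₁}`),
  `weight_shift_le`.
* §1 LATTICE-PATH TELESCOPING `abs_sub_le_of_unit_steps`: unit forward differences `≤ a·e^{−δ|quo N z − p|₁}` at the base
  point ⇒ `|F (u + s) − F u| ≤ |s|₁·a·e^{δ|s|₁}·e^{−δ|quo N u − p|₁}` (induction on `LatticeForm.l1`; `cast_natl1`,
  `natl1_sub_single`).
* §2 BLOCK SUMS: `summable_exp_quo`, `blockAvg_tsum_comp_quo` (`(N^{d+1})⁻¹ Σ'_u f (quo N u) = Σ'_q f q`, by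
  `KKTFluctuationEnergy.tsum_blocks`), `exp_three_le`, `summable_exp_quo_three`, and the THREE-CENTRE BLOCK SUM
  `blockAvg_exp_three_le` (`(N^{d+1})⁻¹ Σ'_u e^{−δ(|quo N u − x′|₁+|quo N u − z′|₁+|quo N u − u′|₁)} ≤
  Zl_{d+1}(δ/2)·e^{−(δ/2)(|x′−u′|₁+|z′−u′|₁)}`) — the three-centre instance of leaf-04-g17's generic W4
  `GAN24/TaylorBlockSum.blockSum_exp_le` (independent bytes; either serves part 2).
* §3 THE REORDERING `sandwich_reorder` (`tsum_eq_sum_sub_of_support`, `tsum_eq_sum_add_of_support`, `inner_eq`,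
  `outer_term_eq`): for a table vanishing unless `w − u ∈ B ∧ y − u ∈ B` (`B` a finite offset box) and summable
  `(t,s)`-slices, the sandwich IN THE VERBATIM NESTING of `e3W_unit_split`'s right-hand side,
  `Σ'_y Σ_{l′} (Σ'_w Σ_l G l w · Σ_κ c · Σ'_u H κ u · (ν · T κ u w y l l′)) · K l′ y`, EQUALS
  `Σ'_u Σ_{t∈B} Σ_{s∈B} Σ_{l′,l,κ} c·ν·(G l (u+s)·H κ u·T κ u (u+s) (u+t) l l′·K l′ (u+t))` — the Fubini step
  `E3UnitSplit` deliberately left undone (`tsum_eq_sum` on finite supports, `Summable.tsum_finsetSum`, the shift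
  `Equiv.subRight t`; no conditionally convergent rearrangement).
NOT HERE: the bound (part 2), (N1)∕(N1′), W1, the instantiation at an2's objects and the residual `N^{d−3}` (row-W
assembly, PART III table), anything about «E3SupRate».
-/

noncomputable section

open Finset
open scoped BigOperators
open Literature.MathematicalPhysics.QuantumFieldTheory Balaban1983to89 Balaban1983to89.Beta
open B12Sec2to5 (l1 l1_nonneg)
open ExpKernelCalculus (Zl l1_sub_triangle l1_sub_symm summable_exp_shift' tsum_exp_shift')
open LatticeForm (quo)
open BlochFibreUniqueness (quo_add_zsmul)
open KKTFluctuationEnergy (tsum_blocks quo_zsmul_add_toSite)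
open KernelSpecInstance (l1_le_l1_quo)
open AffineAveraging (box toSite)

namespace Summit.QuantumFields.BalabanUV.Beta.GAN24.TaylorTrilinearLattice

variable {d : ℕ}

/-! ## §0 Block labels are 1-Lipschitz -/

/-- [folklore] Integer division by `N ≥ 1` is 1-Lipschitz: `|b / N − a / N| ≤ |b − a|`. -/
theorem abs_ediv_sub_ediv_le {N : ℕ} (hN : 0 < N) (a b : ℤ) : |b / (N : ℤ) - a / (N : ℤ)| ≤ |b - a| := by
  have hN' : (0 : ℤ) < N := by exact_mod_cast hN
  have h1N : (1 : ℤ) ≤ N := by exact_mod_cast hN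
  have key : ∀ a b : ℤ, a ≤ b → b / (N : ℤ) - a / (N : ℤ) ≤ b - a := by
    intro a b hab
    have hb := Int.emod_add_mul_ediv b N
    have ha := Int.emod_add_mul_ediv a N
    have hb0 := Int.emod_nonneg b hN'.ne'
    have ha1 := Int.emod_lt_of_pos a hN'
    rcases le_or_gt (b / (N : ℤ) - a / (N : ℤ)) 0 with hk | hk
    · linarith
    · nlinarith [mul_nonneg (sub_nonneg.2 h1N) (sub_nonneg.2 (show (1 : ℤ) ≤ b / (N : ℤ) - a / (N : ℤ) from hk))]
  rw [abs_sub_le_iff]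
  constructor
  · rcases le_total a b with hab | hab
    · exact (key a b hab).trans (le_abs_self _)
    · have := Int.ediv_le_ediv hN' hab
      linarith [abs_nonneg (b - a)]
  · rcases le_total a b with hab | hab
    · have := Int.ediv_le_ediv hN' hab
      linarith [abs_nonneg (b - a)]
    · calc a / (N : ℤ) - b / (N : ℤ) ≤ a - b := key b a hab
        _ ≤ |b - a| := by rw [abs_sub_comm]; exact le_abs_self _

/-- [folklore] BLOCK LABELS MOVE NO FASTER THAN SITES: `|quo N z − quo N u|₁ ≤ |z − u|₁`. -/
theorem l1_quo_sub_quo_le (N : ℕ) [NeZero N] (z u : Fin (d + 1) → ℤ) : l1 (quo N z - quo N u) ≤ l1 (z - u) := by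
  unfold l1
  refine Finset.sum_le_sum fun i _ => ?_
  have h := abs_ediv_sub_ediv_le (Nat.pos_of_ne_zero (NeZero.ne N)) (u i) (z i)
  have h' : (((|z i / (N : ℤ) - u i / (N : ℤ)| : ℤ) : ℝ)) ≤ (((|z i - u i| : ℤ)) : ℝ) := by exact_mod_cast h
  simpa only [quo, Pi.sub_apply, Int.cast_abs, Int.cast_sub] using h'

/-- [folklore] THE BLOCK-LABEL WEIGHT IS SHIFT-STABLE: `e^{−δ|quo N b − p|₁} ≤ e^{δ|b − u|₁} · e^{−δ|quo N u − p|₁}`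
for `δ ≥ 0`. -/
theorem exp_quo_weight_le (N : ℕ) [NeZero N] {δ : ℝ} (hδ : 0 ≤ δ) (b u p : Fin (d + 1) → ℤ) :
    Real.exp (-δ * l1 (quo N b - p)) ≤ Real.exp (δ * l1 (b - u)) * Real.exp (-δ * l1 (quo N u - p)) := by
  rw [← Real.exp_add, Real.exp_le_exp]
  have h1 : l1 (quo N u - p) ≤ l1 (quo N u - quo N b) + l1 (quo N b - p) := l1_sub_triangle _ _ _
  have h2 : l1 (quo N u - quo N b) ≤ l1 (u - b) := l1_quo_sub_quo_le N u b
  rw [l1_sub_symm u b] at h2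
  nlinarith

/-- [folklore] A bound with the block-label weight at a shifted base point `u + s` is a bound with the weight at `u`,
up to the factor `e^{δ|s|₁}`. -/
theorem weight_shift_le (N : ℕ) [NeZero N] {δ C v : ℝ} (hδ : 0 ≤ δ) (hC : 0 ≤ C) (u s p : Fin (d + 1) → ℤ)
    (h : |v| ≤ C * Real.exp (-δ * l1 (quo N (u + s) - p))) :
    |v| ≤ C * Real.exp (δ * l1 s) * Real.exp (-δ * l1 (quo N u - p)) := by
  have hw := exp_quo_weight_le N hδ (u + s) u p
  rw [add_sub_cancel_left] at hw
  calc |v| ≤ C * Real.exp (-δ * l1 (quo N (u + s) - p)) := h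
    _ ≤ C * (Real.exp (δ * l1 s) * Real.exp (-δ * l1 (quo N u - p))) := mul_le_mul_of_nonneg_left hw hC
    _ = _ := by ring

/-! ## §1 Lattice-path telescoping: unit forward differences ⇒ box-Lipschitz -/

/-- [folklore] The `ℕ`-valued `ℓ¹` size `LatticeForm.l1` casts to the real `B12Sec2to5.l1`. -/
theorem cast_natl1 (s : Fin (d + 1) → ℤ) : ((LatticeForm.l1 s : ℕ) : ℝ) = l1 s := by
  unfold LatticeForm.l1 l1
  push_cast
  refine Finset.sum_congr rfl fun i _ => ?_
  rw [Nat.cast_natAbs, Int.cast_abs]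

/-- [folklore] Removing one unit from a nonzero coordinate lowers the `ℕ`-valued `ℓ¹` size by one. -/
theorem natl1_sub_single {s : Fin (d + 1) → ℤ} {j : Fin (d + 1)} {σ : ℤ} (hσ : σ = 1 ∨ σ = -1)
    (hj : 1 ≤ σ * s j) : LatticeForm.l1 (s - Pi.single j σ) + 1 = LatticeForm.l1 s := by
  unfold LatticeForm.l1
  set s₁ : Fin (d + 1) → ℤ := s - Pi.single j σ with hs₁
  have e1 := Finset.add_sum_erase Finset.univ (fun i => (s i).natAbs) (Finset.mem_univ j)
  have e2 := Finset.add_sum_erase Finset.univ (fun i => (s₁ i).natAbs) (Finset.mem_univ j)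
  have h3 : ∑ i ∈ Finset.univ.erase j, (s₁ i).natAbs = ∑ i ∈ Finset.univ.erase j, (s i).natAbs := by
    refine Finset.sum_congr rfl fun i hi => ?_
    rw [hs₁, Pi.sub_apply, Pi.single_eq_of_ne (Finset.ne_of_mem_erase hi), sub_zero]
  have h4 : (s₁ j).natAbs + 1 = (s j).natAbs := by
    rw [hs₁, Pi.sub_apply, Pi.single_eq_same]
    rcases hσ with rfl | rfl <;> omega
  rw [h3] at e2
  omega

/-- [folklore] **LATTICE-PATH TELESCOPING.**  If the unit forward differences of `F` are bounded by
`a · e^{−δ|quo N z − p|₁}` at the base point `z` (all directions), then for every box offset `s`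
`|F (u + s) − F u| ≤ |s|₁ · a · e^{δ|s|₁} · e^{−δ|quo N u − p|₁}` — one unit gradient per unit step of a lattice
path from `u` to `u + s`, every intermediate weight compared to the weight at `u` (`exp_quo_weight_le`). -/
theorem abs_sub_le_of_unit_steps (N : ℕ) [NeZero N] {F : (Fin (d + 1) → ℤ) → ℝ} {a δ : ℝ}
    {p : Fin (d + 1) → ℤ} (ha : 0 ≤ a) (hδ : 0 ≤ δ)
    (hF : ∀ z ν, |F (z + Pi.single ν 1) - F z| ≤ a * Real.exp (-δ * l1 (quo N z - p)))
    (u s : Fin (d + 1) → ℤ) :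
    |F (u + s) - F u| ≤ l1 s * a * Real.exp (δ * l1 s) * Real.exp (-δ * l1 (quo N u - p)) := by
  suffices H : ∀ n : ℕ, ∀ s : Fin (d + 1) → ℤ, LatticeForm.l1 s = n →
      |F (u + s) - F u| ≤ (n : ℝ) * a * Real.exp (δ * n) * Real.exp (-δ * l1 (quo N u - p)) by
    have h := H _ s rfl
    rwa [cast_natl1] at h
  intro n
  induction n with
  | zero =>
    intro s hs
    rw [(LatticeForm.l1_eq_zero_iff s).1 hs, add_zero, sub_self, abs_zero, Nat.cast_zero, zero_mul, zero_mul,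
      zero_mul]
  | succ n ih =>
    intro s hs
    set ω : (Fin (d + 1) → ℤ) → ℝ := fun z => Real.exp (-δ * l1 (quo N z - p)) with hω
    have hne : s ≠ 0 := by intro h; rw [h] at hs; simp [LatticeForm.l1] at hs
    obtain ⟨j, hj⟩ : ∃ j, s j ≠ 0 := by
      by_contra hcon; exact hne (funext fun j => by by_contra h; exact hcon ⟨j, h⟩)
    -- the sign of the step
    obtain ⟨σ, hσ, hσj⟩ : ∃ σ : ℤ, (σ = 1 ∨ σ = -1) ∧ 1 ≤ σ * s j := by
      rcases lt_or_gt_of_ne hj with h | h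
      · exact ⟨-1, Or.inr rfl, by omega⟩
      · exact ⟨1, Or.inl rfl, by omega⟩
    set s' : Fin (d + 1) → ℤ := s - Pi.single j σ with hs'
    have hl : LatticeForm.l1 s' = n := by
      have := natl1_sub_single hσ hσj
      rw [← hs'] at this
      omega
    have hss' : s = s' + Pi.single j σ := by rw [hs', sub_add_cancel]
    have hih := ih s' hl
    -- weights at the two candidate base points
    have hn1 : (n : ℝ) ≤ (n + 1 : ℕ) := by exact_mod_cast Nat.le_succ n
    have hls' : l1 s' = n := by rw [← cast_natl1, hl]
    have hls : l1 s = (n + 1 : ℕ) := by rw [← cast_natl1, hs]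
    have hexp_n : Real.exp (δ * n) ≤ Real.exp (δ * (n + 1 : ℕ)) := Real.exp_le_exp.2 (by nlinarith)
    have hωu : 0 ≤ ω u := (Real.exp_pos _).le
    -- the unit step, in either orientation, costs `a · e^{δ(n+1)} · ω u`
    have hstep : |F (u + s) - F (u + s')| ≤ a * Real.exp (δ * (n + 1 : ℕ)) * ω u := by
      rcases hσ with rfl | rfl
      · -- forward step based at `u + s'`
        have h1 := hF (u + s') j
        rw [add_assoc, ← hss'] at h1
        have h2 := weight_shift_le N hδ ha u s' p h1
        rw [hls'] at h2
        calc |F (u + s) - F (u + s')| ≤ a * Real.exp (δ * n) * ω u := h2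
          _ ≤ a * Real.exp (δ * (n + 1 : ℕ)) * ω u := by gcongr
      · -- backward step: the forward difference based at `u + s`
        have h1 := hF (u + s) j
        have he : u + s + Pi.single j 1 = u + s' := by
          rw [hs', Pi.single_neg, sub_neg_eq_add]; abel
        rw [he, abs_sub_comm] at h1
        have h2 := weight_shift_le N hδ ha u s p h1
        rwa [hls] at h2
    calc |F (u + s) - F u| = |(F (u + s) - F (u + s')) + (F (u + s') - F u)| := by ring_nf
      _ ≤ |F (u + s) - F (u + s')| + |F (u + s') - F u| := abs_add_le _ _
      _ ≤ a * Real.exp (δ * (n + 1 : ℕ)) * ω u + (n : ℝ) * a * Real.exp (δ * n) * ω u := add_le_add hstep hih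
      _ ≤ a * Real.exp (δ * (n + 1 : ℕ)) * ω u + (n : ℝ) * a * Real.exp (δ * (n + 1 : ℕ)) * ω u := by gcongr
      _ = ((n + 1 : ℕ) : ℝ) * a * Real.exp (δ * (n + 1 : ℕ)) * ω u := by push_cast; ring

/-! ## §2 Block sums of block-label weights -/

/-- [folklore] The block-label weight is summable over the FINE lattice (at fixed `N`). -/
theorem summable_exp_quo (N : ℕ) [NeZero N] {δ : ℝ} (hδ : 0 < δ) (p : Fin (d + 1) → ℤ) :
    Summable fun u : Fin (d + 1) → ℤ => Real.exp (-δ * l1 (quo N u - p)) := by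
  have hN : (0 : ℝ) < N := by exact_mod_cast Nat.pos_of_ne_zero (NeZero.ne N)
  refine Summable.of_nonneg_of_le (fun u => (Real.exp_pos _).le) (fun u => ?_)
    ((summable_exp_shift' (div_pos hδ hN) ((N : ℤ) • p)).mul_left (Real.exp (δ * (d + 1))))
  have hq : quo N u - p = quo N (u - (N : ℤ) • p) := by
    rw [sub_eq_add_neg u, ← smul_neg, quo_add_zsmul, sub_eq_add_neg]
  rw [hq, ← Real.exp_add, Real.exp_le_exp]
  have h := l1_le_l1_quo (N := N) (u - (N : ℤ) • p)
  have : δ / N * l1 (u - (N : ℤ) • p) ≤ δ * l1 (quo N (u - (N : ℤ) • p)) + δ * (d + 1) := by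
    rw [div_mul_eq_mul_div, div_le_iff₀ hN]; nlinarith
  linarith

/-- [folklore] **THE BLOCK AVERAGE OF A BLOCK-CONSTANT FUNCTION**: `(N^{d+1})⁻¹ Σ'_u f (quo N u) = Σ'_q f q`
(`KKTFluctuationEnergy.tsum_blocks` + `quo_zsmul_add_toSite`: every block label is hit exactly `N^{d+1}` times). -/
theorem blockAvg_tsum_comp_quo (N : ℕ) [NeZero N] {f : (Fin (d + 1) → ℤ) → ℝ}
    (hf : Summable fun u : Fin (d + 1) → ℤ => f (quo N u)) :
    ((N : ℝ) ^ (d + 1))⁻¹ * ∑' u : Fin (d + 1) → ℤ, f (quo N u) = ∑' q, f q := by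
  rw [tsum_blocks (N := N) hf]
  have hcard : (box (d + 1) N).card = N ^ (d + 1) := by
    simp [AffineAveraging.box, Fintype.card_piFinset, Finset.card_range, Finset.prod_const, Finset.card_univ,
      Fintype.card_fin]
  have hbox : ∀ q : Fin (d + 1) → ℤ,
      ∑ b ∈ box (d + 1) N, f (quo N ((N : ℤ) • q + toSite b)) = (N : ℝ) ^ (d + 1) * f q := by
    intro q
    rw [Finset.sum_congr rfl fun b hb => by rw [quo_zsmul_add_toSite q hb], Finset.sum_const, hcard, nsmul_eq_mul]
    push_cast; ring
  simp_rw [hbox]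
  rw [tsum_mul_left, ← mul_assoc, inv_mul_cancel₀ (pow_ne_zero _ (by exact_mod_cast NeZero.ne N)), one_mul]

/-- [folklore] Three-centre exponent split: `e^{−δ(|q−x|₁+|q−z|₁+|q−u|₁)} ≤ e^{−(δ/2)(|x−u|₁+|z−u|₁)} · e^{−(δ/2)|q−x|₁}`. -/
theorem exp_three_le {δ : ℝ} (hδ : 0 ≤ δ) (q x z u : Fin (d + 1) → ℤ) :
    Real.exp (-δ * (l1 (q - x) + l1 (q - z) + l1 (q - u))) ≤
      Real.exp (-(δ / 2) * (l1 (x - u) + l1 (z - u))) * Real.exp (-(δ / 2) * l1 (q - x)) := by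
  rw [← Real.exp_add, Real.exp_le_exp]
  have h1 : l1 (x - u) ≤ l1 (x - q) + l1 (q - u) := l1_sub_triangle x q u
  have h2 : l1 (z - u) ≤ l1 (z - q) + l1 (q - u) := l1_sub_triangle z q u
  rw [l1_sub_symm x q] at h1
  rw [l1_sub_symm z q] at h2
  nlinarith [l1_nonneg (q - x), l1_nonneg (q - z), l1_nonneg (q - u)]

/-- [folklore] Summability of the three-centre block-label weight over the fine lattice. -/
theorem summable_exp_quo_three (N : ℕ) [NeZero N] {δ : ℝ} (hδ : 0 < δ) (x' z' u' : Fin (d + 1) → ℤ) :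
    Summable fun u : Fin (d + 1) → ℤ =>
      Real.exp (-δ * (l1 (quo N u - x') + l1 (quo N u - z') + l1 (quo N u - u'))) := by
  refine Summable.of_nonneg_of_le (fun u => (Real.exp_pos _).le) (fun u => ?_) (summable_exp_quo N hδ u')
  rw [Real.exp_le_exp]
  nlinarith [l1_nonneg (quo N u - z'), l1_nonneg (quo N u - x')]

/-- [folklore] **THREE-CENTRE BLOCK SUM** (the `W4`-type step of `SKELETON-S3.md` §12.7, three centres):
`(N^{d+1})⁻¹ Σ'_u e^{−δ(|quo N u − x′|₁ + |quo N u − z′|₁ + |quo N u − u′|₁)} ≤ Zl_{d+1}(δ/2) · e^{−(δ/2)(|x′−u′|₁ + |z′−u′|₁)}`. -/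
theorem blockAvg_exp_three_le (N : ℕ) [NeZero N] {δ : ℝ} (hδ : 0 < δ) (x' z' u' : Fin (d + 1) → ℤ) :
    ((N : ℝ) ^ (d + 1))⁻¹ * ∑' u : Fin (d + 1) → ℤ,
        Real.exp (-δ * (l1 (quo N u - x') + l1 (quo N u - z') + l1 (quo N u - u'))) ≤
      Zl (d + 1) (δ / 2) * Real.exp (-(δ / 2) * (l1 (x' - u') + l1 (z' - u'))) := by
  rw [blockAvg_tsum_comp_quo N (f := fun q => Real.exp (-δ * (l1 (q - x') + l1 (q - z') + l1 (q - u'))))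
    (summable_exp_quo_three N hδ x' z' u')]
  have hs1 : Summable fun q : Fin (d + 1) → ℤ => Real.exp (-δ * (l1 (q - x') + l1 (q - z') + l1 (q - u'))) := by
    refine Summable.of_nonneg_of_le (fun u => (Real.exp_pos _).le) (fun q => ?_) (summable_exp_shift' hδ u')
    rw [Real.exp_le_exp]
    nlinarith [l1_nonneg (q - z'), l1_nonneg (q - x')]
  calc ∑' q : Fin (d + 1) → ℤ, Real.exp (-δ * (l1 (q - x') + l1 (q - z') + l1 (q - u')))
      ≤ ∑' q : Fin (d + 1) → ℤ, Real.exp (-(δ / 2) * (l1 (x' - u') + l1 (z' - u'))) * Real.exp (-(δ / 2) * l1 (q - x')) :=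
        Summable.tsum_le_tsum (fun q => exp_three_le hδ.le q x' z' u') hs1
          ((summable_exp_shift' (half_pos hδ) x').mul_left _)
    _ = Real.exp (-(δ / 2) * (l1 (x' - u') + l1 (z' - u'))) * Zl (d + 1) (δ / 2) := by
        rw [tsum_mul_left, tsum_exp_shift']
    _ = _ := mul_comm _ _

/-! ## §3 Reordering the Wilson-channel unit sandwich: `Σ'_y Σ'_w Σ'_u ↦ Σ'_u Σ_{t,s ∈ B}` (finite range of the table) -/

/-- [folklore] A lattice `tsum` whose support lies in `y − B` is the finite sum over `t ∈ B` at `y − t`. -/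
theorem tsum_eq_sum_sub_of_support {f : (Fin (d + 1) → ℤ) → ℝ} (B : Finset (Fin (d + 1) → ℤ))
    (y : Fin (d + 1) → ℤ) (hf : ∀ u, f u ≠ 0 → y - u ∈ B) : ∑' u, f u = ∑ t ∈ B, f (y - t) := by
  classical
  have hsupp : ∀ u ∉ B.map ⟨fun t => y - t, sub_right_injective⟩, f u = 0 := by
    intro u hu; by_contra h; exact hu (Finset.mem_map.2 ⟨y - u, hf u h, by simp⟩)
  rw [tsum_eq_sum hsupp, Finset.sum_map]
  rfl

/-- [folklore] A lattice `tsum` whose support lies in `u + B` is the finite sum over `s ∈ B` at `u + s`. -/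
theorem tsum_eq_sum_add_of_support {f : (Fin (d + 1) → ℤ) → ℝ} (B : Finset (Fin (d + 1) → ℤ))
    (u : Fin (d + 1) → ℤ) (hf : ∀ w, f w ≠ 0 → w - u ∈ B) : ∑' w, f w = ∑ s ∈ B, f (u + s) := by
  classical
  have hsupp : ∀ w ∉ B.map ⟨fun s => u + s, add_right_injective u⟩, f w = 0 := by
    intro w hw; by_contra h; exact hw (Finset.mem_map.2 ⟨w - u, hf w h, by simp⟩)
  rw [tsum_eq_sum hsupp, Finset.sum_map]
  rfl

section Reorder

variable (G K H : Fin (d + 1) → (Fin (d + 1) → ℤ) → ℝ)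
  (T : Fin (d + 1) → (Fin (d + 1) → ℤ) → (Fin (d + 1) → ℤ) → (Fin (d + 1) → ℤ) → Fin (d + 1) → Fin (d + 1) → ℝ)
  (B : Finset (Fin (d + 1) → ℤ)) (c ν : ℝ)

/-- [folklore] THE INNER IDENTITY at a fixed outer site `y` and column index `l′`: with the table `T κ u w y l l′`
vanishing unless `w − u ∈ B` and `y − u ∈ B`, the two inner `tsum`s of the sandwich are finite sums over the offsets
`t = y − u ∈ B`, `s = w − u ∈ B`. -/
theorem inner_eq (hTw : ∀ κ u w y l l', w - u ∉ B → T κ u w y l l' = 0)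
    (hTy : ∀ κ u w y l l', y - u ∉ B → T κ u w y l l' = 0) (y : Fin (d + 1) → ℤ) (l' : Fin (d + 1)) :
    (∑' w, ∑ l, G l w * ∑ κ, c * ∑' u, H κ u * (ν * T κ u w y l l')) =
      ∑ t ∈ B, ∑ s ∈ B, ∑ l, ∑ κ, c * ν * (G l (y - t + s) * H κ (y - t) * T κ (y - t) (y - t + s) y l l') := by
  have h1 : ∀ κ w l, ∑' u, H κ u * (ν * T κ u w y l l') = ∑ t ∈ B, H κ (y - t) * (ν * T κ (y - t) w y l l') := by
    intro κ w l
    refine tsum_eq_sum_sub_of_support B y (fun u hu => ?_)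
    by_contra h
    exact hu (by rw [hTy κ u w y l l' h, mul_zero, mul_zero])
  simp_rw [h1]
  have h2 : ∀ w, (∑ l, G l w * ∑ κ, c * ∑ t ∈ B, H κ (y - t) * (ν * T κ (y - t) w y l l')) =
      ∑ t ∈ B, ∑ l, ∑ κ, c * ν * (G l w * H κ (y - t) * T κ (y - t) w y l l') := by
    intro w
    simp only [Finset.mul_sum]
    calc ∑ l, ∑ κ, ∑ t ∈ B, G l w * (c * (H κ (y - t) * (ν * T κ (y - t) w y l l')))
        = ∑ l, ∑ t ∈ B, ∑ κ, G l w * (c * (H κ (y - t) * (ν * T κ (y - t) w y l l'))) :=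
          Finset.sum_congr rfl fun l _ => Finset.sum_comm
      _ = ∑ t ∈ B, ∑ l, ∑ κ, G l w * (c * (H κ (y - t) * (ν * T κ (y - t) w y l l'))) := Finset.sum_comm
      _ = _ := Finset.sum_congr rfl fun t _ => Finset.sum_congr rfl fun l _ =>
            Finset.sum_congr rfl fun κ _ => by ring
  simp_rw [h2]
  have hzero : ∀ t w, w - (y - t) ∉ B →
      (∑ l, ∑ κ, c * ν * (G l w * H κ (y - t) * T κ (y - t) w y l l')) = 0 := by
    intro t w hw
    refine Finset.sum_eq_zero fun l _ => Finset.sum_eq_zero fun κ _ => ?_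
    rw [hTw κ (y - t) w y l l' hw, mul_zero, mul_zero]
  have hsum : ∀ t ∈ B, Summable fun w => ∑ l, ∑ κ, c * ν * (G l w * H κ (y - t) * T κ (y - t) w y l l') := by
    intro t _
    classical
    refine summable_of_ne_finset_zero (s := B.map ⟨fun s => (y - t) + s, add_right_injective (y - t)⟩) ?_
    intro w hw
    refine hzero t w fun hmem => hw ?_
    exact Finset.mem_map.2 ⟨w - (y - t), hmem, by simp⟩
  rw [Summable.tsum_finsetSum hsum]
  refine Finset.sum_congr rfl fun t _ => ?_
  exact tsum_eq_sum_add_of_support B (y - t) (fun w hw => by by_contra h; exact hw (hzero t w h))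

/-- [folklore] The outer term at a fixed `y`, fully regrouped by the offsets `(t, s) ∈ B × B`. -/
theorem outer_term_eq (hTw : ∀ κ u w y l l', w - u ∉ B → T κ u w y l l' = 0)
    (hTy : ∀ κ u w y l l', y - u ∉ B → T κ u w y l l' = 0) (y : Fin (d + 1) → ℤ) :
    (∑ l', (∑' w, ∑ l, G l w * ∑ κ, c * ∑' u, H κ u * (ν * T κ u w y l l')) * K l' y) =
      ∑ t ∈ B, ∑ s ∈ B, ∑ l', ∑ l, ∑ κ,
        c * ν * (G l (y - t + s) * H κ (y - t) * T κ (y - t) (y - t + s) y l l' * K l' y) := by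
  simp_rw [inner_eq G H T B c ν hTw hTy y]
  simp only [Finset.sum_mul]
  calc ∑ l', ∑ t ∈ B, ∑ s ∈ B, ∑ l, ∑ κ,
        c * ν * (G l (y - t + s) * H κ (y - t) * T κ (y - t) (y - t + s) y l l') * K l' y
      = ∑ t ∈ B, ∑ l', ∑ s ∈ B, ∑ l, ∑ κ,
        c * ν * (G l (y - t + s) * H κ (y - t) * T κ (y - t) (y - t + s) y l l') * K l' y := Finset.sum_comm
    _ = ∑ t ∈ B, ∑ s ∈ B, ∑ l', ∑ l, ∑ κ,
        c * ν * (G l (y - t + s) * H κ (y - t) * T κ (y - t) (y - t + s) y l l') * K l' y :=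
          Finset.sum_congr rfl fun t _ => Finset.sum_comm
    _ = _ := Finset.sum_congr rfl fun t _ => Finset.sum_congr rfl fun s _ => Finset.sum_congr rfl fun l' _ =>
          Finset.sum_congr rfl fun l _ => Finset.sum_congr rfl fun κ _ => by ring

/-- [folklore] **THE REORDERING** (the Fubini step `E3UnitSplit` deliberately left undone): under the finite range of
the table and the summability of every `(t, s)`-slice in the vertex location `u`, the Wilson-channel unit sandwich in
the VERBATIM nesting of `E3UnitSplit.e3W_unit_split` equals ONE lattice sum over the vertex location of FINITE sums
over the two offsets:
`Σ'_y Σ_{l′} (Σ'_w Σ_l G l w · Σ_κ c · Σ'_u H κ u · (ν · T κ u w y l l′)) · K l′ y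
   = Σ'_u Σ_{t∈B} Σ_{s∈B} Σ_{l′,l,κ} c·ν·(G l (u+s) · H κ u · T κ u (u+s) (u+t) l l′ · K l′ (u+t))`. -/
theorem sandwich_reorder (hTw : ∀ κ u w y l l', w - u ∉ B → T κ u w y l l' = 0)
    (hTy : ∀ κ u w y l l', y - u ∉ B → T κ u w y l l' = 0)
    (hS : ∀ t ∈ B, ∀ s ∈ B, Summable fun u : Fin (d + 1) → ℤ =>
      ∑ l', ∑ l, ∑ κ, c * ν * (G l (u + s) * H κ u * T κ u (u + s) (u + t) l l' * K l' (u + t))) :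
    (∑' y, ∑ l', (∑' w, ∑ l, G l w * ∑ κ, c * ∑' u, H κ u * (ν * T κ u w y l l')) * K l' y) =
      ∑' u, ∑ t ∈ B, ∑ s ∈ B, ∑ l', ∑ l, ∑ κ,
        c * ν * (G l (u + s) * H κ u * T κ u (u + s) (u + t) l l' * K l' (u + t)) := by
  refine (tsum_congr (outer_term_eq G K H T B c ν hTw hTy)).trans ?_
  have hSy : ∀ t ∈ B, ∀ s ∈ B, Summable fun y : Fin (d + 1) → ℤ => ∑ l', ∑ l, ∑ κ,
      c * ν * (G l (y - t + s) * H κ (y - t) * T κ (y - t) (y - t + s) y l l' * K l' y) := by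
    intro t ht s hs
    refine ((Equiv.subRight t).summable_iff.2 (hS t ht s hs)).congr fun y => ?_
    simp only [Function.comp_apply, Equiv.subRight_apply, sub_add_cancel]
  rw [Summable.tsum_finsetSum (fun t ht => summable_sum fun s hs => hSy t ht s hs),
    Summable.tsum_finsetSum (fun t ht => summable_sum fun s hs => hS t ht s hs)]
  refine Finset.sum_congr rfl fun t ht => ?_
  rw [Summable.tsum_finsetSum (fun s hs => hSy t ht s hs), Summable.tsum_finsetSum (fun s hs => hS t ht s hs)]
  refine Finset.sum_congr rfl fun s _ => ?_
  refine (tsum_congr fun y => ?_).trans ((Equiv.subRight t).tsum_eq _)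
  simp only [Equiv.subRight_apply, sub_add_cancel]

end Reorder

end Summit.QuantumFields.BalabanUV.Beta.GAN24.TaylorTrilinearLattice

end
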